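import Summits.CriticalPhenomena.CardyFormulaZ2.Theorems.CardyIKTransportCornerLineDescentFreezeSandwich

/-!
# The frozen end `p = 0` of the corner line: the reduction of `stub_FreezeHomogenisation` to crude-crossing continuity

Support file for the registered stub `stub_FreezeHomogenisation` of the line `symmetric-seed-second-order` of the
crux `CardyIKTransport.CornerLineDescent` (stmt-CriticalPhenomena-10964).  THE REDUCTION (anchor
`stub_FreezeHomogenisation_of_continuity`): `(∀ R, Freeze.CrudeCrossingContinuity R) →` the stub verbatim; at one
rectangle `CrudeCrossingContinuity R → FreezeComparisonAt R → FreezeHomogenisationAt R`.  Proof: the frozen crossing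
probability lives on the four fair factors (`freezeEmbed` is a measurable embedding, the frozen open-edge map is
measurable); Fubini over the grid (`prod_prod_sandwich`) with the sandwich of `…FreezeSandwich` on good grids and the
law of the coupling (`map_couplingMap`) gives `P(lower) - 2b ≤ gaugeCrossingProb 0 (e^{iπ/4}R) δ ≤ P(upper) + 2b`,
`b = P[bad grid]` (`gaugeCrossingProb_zero_mem_Icc`); the standard family at mesh `2δ` lies in `[P(lower), P(upper)]`
(`…FreezeContinuity`), `b → 0` as `δ → 0⁺` (window `M ≍ 1/δ`, `…FreezeRenewal2`), and continuity makes `P(upper) -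
P(lower)` small.  So the stub is EXACTLY as hard as `CrudeCrossingContinuity` (SS11 Lemma 5.1/6.1 type, crude events).
References: Schramm–Smirnov, Ann. Probab. 39 (2011) §5–6; route file `Theses/CardyIKTransport.lean` (item 10964).
-/

noncomputable section

namespace Summit.CriticalPhenomena.CardyFormulaZ2.Theorems.CornerLineDescent.SymmetricSeed

open scoped BigOperators Topology Classical MeasureTheory ProbabilityTheory ENNReal NNReal
open Filter Set Function MeasureTheory
open Literature.Probability.Percolation (sitePercolation bondPercolation half BondConfig embDomainCrossing rectangle
  openGraph openGraph_adj openConnIn openCrossing)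
open Literature.Probability.LatticeModels
open Literature.Probability.RandomPlanarGeometry

namespace Freeze

/-! ## Measurability of the frozen crossing event; the frozen crossing probability on the four fair factors -/

/-- The space of the four fair factors (column bits, row bits, unused field, coins). [folklore] -/
abbrev FairSpace : Type := Set ℤ × (Set ℤ × (Set (Site 2) × Set (Site 2)))

/-- The frozen open-edge map `ω₀ ↦ gaugeEdges (freezeEmbed ω₀)` is measurable: with no syndromes an edge is decided by
two column bits, two row bits and two coins. [folklore] -/
theorem measurable_frozenEdges : Measurable fun ω₀ : FairSpace => gaugeEdges (freezeEmbed ω₀) := by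
  refine measurable_set_iff.2 fun e => ?_
  induction e using Sym2.ind with
  | _ u v =>
    have hcol : ∀ w : Site 2, Measurable fun ω₀ : FairSpace => gaugeColour (freezeEmbed ω₀) w := by
      intro w
      have h : (fun ω₀ : FairSpace => gaugeColour (freezeEmbed ω₀) w) =
          fun ω₀ => Xor (w 0 ∈ ω₀.1) (w 1 ∈ ω₀.2.1) := by
        funext ω₀; exact propext (gaugeColour_iff_of_empty (ω := freezeEmbed ω₀) rfl w)
      rw [h]
      have h1 : Measurable fun ω₀ : FairSpace => w 0 ∈ ω₀.1 := (measurable_set_mem _).comp measurable_fst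
      have h2 : Measurable fun ω₀ : FairSpace => w 1 ∈ ω₀.2.1 :=
        (measurable_set_mem _).comp (measurable_fst.comp measurable_snd)
      exact (h1.and h2.not).or (h2.and h1.not)
    have hcoin : ∀ w : Site 2, Measurable fun ω₀ : FairSpace => gaugeCoin (freezeEmbed ω₀) w := by
      intro w
      have h : (fun ω₀ : FairSpace => gaugeCoin (freezeEmbed ω₀) w) = fun ω₀ => w ∈ ω₀.2.2.2 := by
        funext ω₀; exact propext (gaugeCoin_iff' (freezeEmbed ω₀) w)
      rw [h]; exact (measurable_set_mem _).comp (measurable_snd.comp (measurable_snd.comp measurable_snd))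
    have hstep : ∀ a b : Site 2, Measurable fun ω₀ : FairSpace => Step (freezeEmbed ω₀) a b := fun a b =>
      (measurable_const.or (measurable_const.or ((measurable_const.and (hcoin a).not).or
        (measurable_const.and (hcoin _)))))
    have h : (fun ω₀ : FairSpace => s(u, v) ∈ gaugeEdges (freezeEmbed ω₀)) = fun ω₀ =>
        (gaugeColour (freezeEmbed ω₀) u ∧ gaugeColour (freezeEmbed ω₀) v ∧ Step (freezeEmbed ω₀) u v) ∨
        (gaugeColour (freezeEmbed ω₀) v ∧ gaugeColour (freezeEmbed ω₀) u ∧ Step (freezeEmbed ω₀) v u) := by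
      funext ω₀; exact propext (mem_gaugeEdges_iff _ u v)
    rw [h]
    exact ((hcol u).and ((hcol v).and (hstep u v))).or ((hcol v).and ((hcol u).and (hstep v u)))

/-- The pulled-back crossing event on the four fair factors is measurable. [folklore] -/
theorem measurableSet_preimage_crossingEvent (R : ConformalRectangle) (δ : ℝ) : MeasurableSet (freezeEmbed ⁻¹' crossingEvent R δ) :=
  (Literature.Probability.Percolation.measurableSet_embDomainCrossing _ _ _ _ _).preimage measurable_frozenEdges

/-- `freezeEmbed` is a measurable embedding (left inverse: forget the syndromes). [folklore] -/
theorem measurableEmbedding_freezeEmbed : MeasurableEmbedding freezeEmbed := by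
  refine MeasurableEmbedding.of_measurable_inverse (g := fun b : Bits => (b.1, b.2.1, b.2.2.2))
    measurable_freezeEmbed ?_ (by fun_prop) fun _ => rfl
  have h : Set.range freezeEmbed = (fun b : Bits => b.2.2.1) ⁻¹' {∅} := by
    ext b
    simp only [Set.mem_range, Set.mem_preimage, Set.mem_singleton_iff]
    constructor
    · rintro ⟨ω₀, rfl⟩; rfl
    · intro hb; exact ⟨(b.1, b.2.1, b.2.2.2), by obtain ⟨b1, b2, b3, b4⟩ := b; simp only at hb; subst hb; rfl⟩
  rw [h]
  exact (measurableSet_singleton _).preimage (by fun_prop)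

/-- THE FROZEN CROSSING PROBABILITY ON THE FOUR FAIR FACTORS (no measurability of the event on `Bits` needed). [folklore] -/
theorem gaugeCrossingProb_zero_eq_fairBits (R : ConformalRectangle) (δ : ℝ) :
    gaugeCrossingProb 0 R δ = fairBits.real (freezeEmbed ⁻¹' crossingEvent R δ) := by
  rw [gaugeCrossingProb, gaugeMeasure_zero_eq_map, measureReal_def, measureReal_def, measurableEmbedding_freezeEmbed.map_apply]

/-! ## Fubini sandwich over the grid -/

/-- ABSTRACT FUBINI SANDWICH.  For a measurable `G ⊆ α × (α × β)` under `μ ⊗ (μ ⊗ ν)` (probability measures), if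
the `ν`-measure of the section of `G` over `(a, a')` lies in `[lo, hi]` whenever `a, a'` are good, then
`μ ⊗ μ ⊗ ν (G) ≤ hi + 2 μ(goodᶜ)` and `lo · μ(good)² ≤ μ ⊗ μ ⊗ ν (G)`. [folklore] -/
theorem prod_prod_sandwich {α β : Type*} [MeasurableSpace α] [MeasurableSpace β] (μ : Measure α) (ν : Measure β)
    [IsProbabilityMeasure μ] [IsProbabilityMeasure ν] {G : Set (α × (α × β))} (hG : MeasurableSet G)
    {good : Set α} (hgood : MeasurableSet good) {lo hi : ℝ≥0∞}
    (hhi : ∀ a ∈ good, ∀ a' ∈ good, ν {q | (a, (a', q)) ∈ G} ≤ hi)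
    (hlo : ∀ a ∈ good, ∀ a' ∈ good, lo ≤ ν {q | (a, (a', q)) ∈ G}) :
    (μ.prod (μ.prod ν)) G ≤ hi + 2 * μ goodᶜ ∧ lo * (μ good * μ good) ≤ (μ.prod (μ.prod ν)) G := by
  have hsec : ∀ a, MeasurableSet (Prod.mk a ⁻¹' G) := fun a => hG.preimage measurable_prodMk_left
  rw [Measure.prod_apply hG]
  have hinner : ∀ a, (μ.prod ν) (Prod.mk a ⁻¹' G) = ∫⁻ a', ν {q | (a, (a', q)) ∈ G} ∂μ := fun a => by
    rw [Measure.prod_apply (hsec a)]; rfl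
  simp_rw [hinner]
  constructor
  · -- upper bound: section ≤ hi + 1_{bad}(a) + 1_{bad}(a')
    have hpt : ∀ a a', ν {q | (a, (a', q)) ∈ G} ≤ hi + goodᶜ.indicator 1 a + goodᶜ.indicator 1 a' := by
      intro a a'
      by_cases ha : a ∈ good
      · by_cases ha' : a' ∈ good
        · exact (hhi a ha a' ha').trans (le_self_add.trans le_self_add)
        · have h1 : goodᶜ.indicator (1 : α → ℝ≥0∞) a' = 1 := by simp [Set.indicator, ha']
          rw [h1]
          exact prob_le_one.trans le_add_self
      · have h1 : goodᶜ.indicator (1 : α → ℝ≥0∞) a = 1 := by simp [Set.indicator, ha]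
        rw [h1]
        exact prob_le_one.trans (le_add_self.trans le_self_add)
    have hmi : Measurable (goodᶜ.indicator (1 : α → ℝ≥0∞)) := measurable_one.indicator hgood.compl
    calc ∫⁻ a, ∫⁻ a', ν {q | (a, (a', q)) ∈ G} ∂μ ∂μ
        ≤ ∫⁻ a, ∫⁻ a', hi + goodᶜ.indicator 1 a + goodᶜ.indicator 1 a' ∂μ ∂μ :=
          lintegral_mono fun a => lintegral_mono fun a' => hpt a a'
      _ = ∫⁻ a, (hi + goodᶜ.indicator 1 a + μ goodᶜ) ∂μ := by
          refine lintegral_congr fun a => ?_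
          rw [lintegral_add_left (by fun_prop), lintegral_const, lintegral_indicator_one hgood.compl]
          simp
      _ = hi + μ goodᶜ + μ goodᶜ := by
          rw [lintegral_add_right _ measurable_const, lintegral_add_left measurable_const, lintegral_const,
            lintegral_const, lintegral_indicator_one hgood.compl]
          simp
      _ = hi + 2 * μ goodᶜ := by rw [two_mul, add_assoc]
  · -- lower bound: section ≥ lo · 1_{good}(a) · 1_{good}(a')
    have hpt : ∀ a a', lo * good.indicator 1 a * good.indicator 1 a' ≤ ν {q | (a, (a', q)) ∈ G} := by
      intro a a'
      by_cases ha : a ∈ good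
      · by_cases ha' : a' ∈ good
        · simpa [Set.indicator, ha, ha'] using hlo a ha a' ha'
        · simp [Set.indicator, ha']
      · simp [Set.indicator, ha]
    calc lo * (μ good * μ good) = ∫⁻ a, ∫⁻ a', lo * good.indicator 1 a * good.indicator 1 a' ∂μ ∂μ := by
          have h1 : ∀ a, ∫⁻ a', lo * good.indicator 1 a * good.indicator 1 a' ∂μ =
              lo * good.indicator 1 a * μ good := fun a => by
            rw [lintegral_const_mul _ (measurable_one.indicator hgood), lintegral_indicator_one hgood]
          simp_rw [h1]
          have h2 : (fun a => lo * good.indicator 1 a * μ good) = fun a => lo * μ good * good.indicator (1 : α → ℝ≥0∞) a := by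
            funext a; ring
          rw [h2, lintegral_const_mul _ (measurable_one.indicator hgood), lintegral_indicator_one hgood]
          ring
      _ ≤ _ := lintegral_mono fun a => lintegral_mono fun a' => hpt a a'

/-! ## The sections of the frozen crossing event over a good grid -/

section Sections

/-- The black class read on the two bit sequences. [folklore] -/
def clsAB (A B : Set ℤ) : ℤ := if Xor ((0 : ℤ) ∈ A) ((0 : ℤ) ∈ B) then 0 else 1

/-- The coupling map of the grid `(A, B)` (normalised flip enumerations from flips unbounded both ways). [folklore] -/
def gridCoupling {A B : Set ℤ} (hA : (∀ N : ℤ, ∃ k, N < k ∧ IsFlip A k) ∧ ∀ N : ℤ, ∃ k, k < N ∧ IsFlip A k)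
    (hB : (∀ N : ℤ, ∃ k, N < k ∧ IsFlip B k) ∧ ∀ N : ℤ, ∃ k, k < N ∧ IsFlip B k) :
    Set (Site 2) → BondConfig (Site 2) :=
  couplingMap (FlipEnum.ofUnbounded hA.1 hA.2) (FlipEnum.ofUnbounded hB.1 hB.2) (clsAB A B)

variable {A B : Set ℤ} {M : ℕ} {θ δ ρ Rad κ : ℝ} (hA : GoodGrid A M θ) (hB : GoodGrid B M θ) (hδ : 0 < δ)
  (hRM : 2 * Rad + 4 * δ ≤ δ * M) (hdisp : δ * (2 * θ * M + 6) ≤ ρ) (R : ConformalRectangle)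

include hA hB hδ hRM hdisp in
/-- UPPER SECTION: over a good grid, the section of the frozen crossing event of `e^{iπ/4} R` at mesh `δ` lies in the
pull-back of the upper event of `R` at mesh `2δ` along the coupling map. [folklore] -/
theorem section_subset_upper (hRad : R.carrier ⊆ Metric.ball 0 Rad) :
    {q : Set (Site 2) × Set (Site 2) | (A, (B, q)) ∈ freezeEmbed ⁻¹' crossingEvent (R.map rotEighth) δ} ⊆
      Prod.snd ⁻¹' (gridCoupling ⟨hA.1, hA.2.1⟩ ⟨hB.1, hB.2.1⟩ ⁻¹' upperCrossing R ρ (2 * δ)) := by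
  intro q hq
  exact couplingMap_mem_upperCrossing (ω := freezeEmbed (A, (B, q))) rfl (FlipEnum.ofUnbounded hA.1 hA.2.1)
    (FlipEnum.ofUnbounded hB.1 hB.2.1) (FlipEnum.ofUnbounded_pos_zero_le hA.1 hA.2.1)
    (FlipEnum.ofUnbounded_pos_zero_le hB.1 hB.2.1) hδ hA.2.2 hB.2.2 hRM hdisp R hRad hq

include hA hB hδ hRM hdisp in
/-- LOWER SECTION: over a good grid, the pull-back of the lower event of `R` at mesh `2δ` lies in the section of the
frozen crossing event of `e^{iπ/4} R` at mesh `δ`. [folklore] -/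
theorem lower_subset_section (hθ : θ ≤ 1 / 2) (hρ : 0 ≤ ρ) (hκ : Real.sqrt 2 * δ ≤ κ)
    (hRad : enlarge R κ ⊆ Metric.ball 0 Rad) :
    Prod.snd ⁻¹' (gridCoupling ⟨hA.1, hA.2.1⟩ ⟨hB.1, hB.2.1⟩ ⁻¹' lowerCrossing R κ ρ (2 * δ)) ⊆
      {q : Set (Site 2) × Set (Site 2) | (A, (B, q)) ∈ freezeEmbed ⁻¹' crossingEvent (R.map rotEighth) δ} := by
  intro q hq
  exact mem_crossingEvent_of_couplingMap_mem_lowerCrossing (ω := freezeEmbed (A, (B, q))) rfl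
    (FlipEnum.ofUnbounded hA.1 hA.2.1) (FlipEnum.ofUnbounded hB.1 hB.2.1)
    (FlipEnum.ofUnbounded_pos_zero_le hA.1 hA.2.1) (FlipEnum.ofUnbounded_pos_zero_le hB.1 hB.2.1) hδ hA.2.2 hB.2.2
    hRM hθ hdisp hρ hκ R hRad hq

/-- THE LAW OF A SECTION: coins pulled back along the coupling map of a grid give the `P_{1/2}`-probability of the
lattice event (the unused field integrates out). [folklore] -/
theorem coinLaw_preimage_gridCoupling (hA' : (∀ N : ℤ, ∃ k, N < k ∧ IsFlip A k) ∧ ∀ N : ℤ, ∃ k, k < N ∧ IsFlip A k)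
    (hB' : (∀ N : ℤ, ∃ k, N < k ∧ IsFlip B k) ∧ ∀ N : ℤ, ∃ k, k < N ∧ IsFlip B k) {E : Set (BondConfig (Site 2))}
    (hE : MeasurableSet E) :
    ((sitePercolation (Site 2) half).prod (sitePercolation (Site 2) half))
        (Prod.snd ⁻¹' (gridCoupling hA' hB' ⁻¹' E)) = bondPercolation (zdGraph 2) half E := by
  rw [← Set.univ_prod, Measure.prod_prod, measure_univ, one_mul, gridCoupling,
    ← Measure.map_apply (measurable_couplingMap _ _ _) hE, map_couplingMap]

end Sections

/-! ## The frozen crossing probability is sandwiched, up to the bad-grid probability -/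

/-- THE TWO-SIDED BOUND AT ONE MESH.  With the parameters of the sandwich (`2 Rad + 4δ ≤ δ M`, `θ ≤ 1/2`,
`δ(2θM + 6) ≤ ρ`, `√2 δ ≤ κ`, carrier and enlarged domain inside the ball of radius `Rad`), writing
`b = P[¬ GoodGrid · M θ]`:  `P(lower R κ ρ (2δ)) - 2b ≤ gaugeCrossingProb 0 (e^{iπ/4} R) δ ≤ P(upper R ρ (2δ)) + 2b`.
[folklore] -/
theorem gaugeCrossingProb_zero_mem_Icc {M : ℕ} {θ δ ρ Rad κ : ℝ} (hδ : 0 < δ) (hθ : θ ≤ 1 / 2)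
    (hRM : 2 * Rad + 4 * δ ≤ δ * M) (hdisp : δ * (2 * θ * M + 6) ≤ ρ) (hρ : 0 ≤ ρ) (hκ : Real.sqrt 2 * δ ≤ κ)
    (R : ConformalRectangle) (hRadΩ : R.carrier ⊆ Metric.ball 0 Rad) (hRadE : enlarge R κ ⊆ Metric.ball 0 Rad) :
    (bondPercolation (zdGraph 2) half).real (lowerCrossing R κ ρ (2 * δ)) -
        2 * bitLaw.real {A | ¬ GoodGrid A M θ} ≤ gaugeCrossingProb 0 (R.map rotEighth) δ ∧
      gaugeCrossingProb 0 (R.map rotEighth) δ ≤ (bondPercolation (zdGraph 2) half).real (upperCrossing R ρ (2 * δ)) +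
        2 * bitLaw.real {A | ¬ GoodGrid A M θ} := by
  set P := bondPercolation (zdGraph 2) half with hP
  set μ₂ := sitePercolation (Site 2) half with hμ₂
  set G := freezeEmbed ⁻¹' crossingEvent (R.map rotEighth) δ with hG
  have hGm : MeasurableSet G := measurableSet_preimage_crossingEvent _ _
  have hgood : MeasurableSet {A | GoodGrid A M θ} := measurableSet_goodGrid M θ
  have key := prod_prod_sandwich bitLaw (μ₂.prod μ₂) hGm hgood (lo := P (lowerCrossing R κ ρ (2 * δ)))
    (hi := P (upperCrossing R ρ (2 * δ)))
    (fun A hA B hB => by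
      refine (measure_mono (section_subset_upper hA hB hδ hRM hdisp R hRadΩ)).trans (le_of_eq ?_)
      exact coinLaw_preimage_gridCoupling _ _ (Literature.Probability.Percolation.measurableSet_openCrossing_of_countable _ _ _))
    (fun A hA B hB => by
      refine (le_of_eq ?_).trans (measure_mono (lower_subset_section hA hB hδ hRM hdisp R hθ hρ hκ hRadE))
      exact (coinLaw_preimage_gridCoupling _ _ (Literature.Probability.Percolation.measurableSet_openCrossing_of_countable _ _ _)).symm)
  have hfair : fairBits = bitLaw.prod (bitLaw.prod (μ₂.prod μ₂)) := rfl
  have hgauge : gaugeCrossingProb 0 (R.map rotEighth) δ = (fairBits G).toReal := by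
    rw [gaugeCrossingProb_zero_eq_fairBits]; rfl
  rw [hgauge, hfair]
  have hcompl : bitLaw.real {A | ¬ GoodGrid A M θ} = 1 - bitLaw.real {A | GoodGrid A M θ} := by
    rw [show {A | ¬ GoodGrid A M θ} = {A | GoodGrid A M θ}ᶜ from rfl, measureReal_compl hgood]; simp
  obtain ⟨k1, k2⟩ := key
  set g := bitLaw.real {A | GoodGrid A M θ} with hg
  constructor
  · -- lower
    have h1 := ENNReal.toReal_mono (measure_ne_top _ _) k2
    rw [ENNReal.toReal_mul, ENNReal.toReal_mul] at h1
    change P.real (lowerCrossing R κ ρ (2 * δ)) * (g * g) ≤ ((bitLaw.prod (bitLaw.prod (μ₂.prod μ₂))) G).toReal at h1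
    have hb0 : 0 ≤ g := measureReal_nonneg
    have hb1 : g ≤ 1 := measureReal_le_one
    have hp0 : 0 ≤ P.real (lowerCrossing R κ ρ (2 * δ)) := measureReal_nonneg
    have hp1 : P.real (lowerCrossing R κ ρ (2 * δ)) ≤ 1 := measureReal_le_one
    rw [hcompl]
    have e : P.real (lowerCrossing R κ ρ (2 * δ)) - P.real (lowerCrossing R κ ρ (2 * δ)) * (g * g) =
        P.real (lowerCrossing R κ ρ (2 * δ)) * (1 - g) * (1 + g) := by ring
    have f : P.real (lowerCrossing R κ ρ (2 * δ)) * (1 - g) * (1 + g) ≤ 1 * (1 - g) * 2 :=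
      mul_le_mul (mul_le_mul_of_nonneg_right hp1 (by linarith)) (by linarith) (by positivity)
        (mul_nonneg zero_le_one (by linarith))
    linarith
  · -- upper
    have h1 := ENNReal.toReal_mono (by finiteness) k1
    rw [ENNReal.toReal_add (measure_ne_top _ _) (by finiteness), ENNReal.toReal_mul] at h1
    simp only [← measureReal_def, Set.compl_setOf, ENNReal.toReal_ofNat] at h1
    exact h1

/-! ## The reduction: continuity of crude crossings ⇒ the finite-mesh comparison ⇒ the stub -/

/-- Points of a collar are within `κ` of the frontier, hence in the ball of any radius exceeding `sup ‖Ω‖ + κ`. [folklore] -/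
theorem enlarge_subset_ball (R : ConformalRectangle) {Rad₀ κ : ℝ} (hΩ : R.carrier ⊆ Metric.ball 0 Rad₀) (hκ : 0 ≤ κ) :
    enlarge R κ ⊆ Metric.ball 0 (Rad₀ + κ + 1) := by
  have hcl : closure R.carrier ⊆ Metric.closedBall 0 Rad₀ :=
    (closure_mono hΩ).trans Metric.closure_ball_subset_closedBall
  have hcollar : ∀ i, sideCollar R i κ ⊆ Metric.ball 0 (Rad₀ + κ + 1) := by
    intro i p hp
    obtain ⟨a, ha, hpa⟩ := (Metric.infDist_lt_iff ⟨_, R.pt_mem_arc_self i⟩).1 hp.1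
    have ha' : ‖a‖ ≤ Rad₀ := by
      have := hcl (frontier_subset_closure (R.arc_subset_frontier i ha))
      simpa using this
    rw [Metric.mem_ball, dist_zero_right]
    calc ‖p‖ = ‖(p - a) + a‖ := by rw [sub_add_cancel]
      _ ≤ ‖p - a‖ + ‖a‖ := norm_add_le _ _
      _ < κ + Rad₀ + 1 := by rw [← Complex.dist_eq]; linarith
      _ = Rad₀ + κ + 1 := by ring
  rintro p ((hp | hp) | hp)
  · have := hΩ hp
    rw [Metric.mem_ball, dist_zero_right] at this ⊢
    linarith
  · exact hcollar 0 hp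
  · exact hcollar 2 hp

/-- `√2 ≤ 3/2`. [folklore] -/
theorem sqrt_two_le_three_halves : Real.sqrt 2 ≤ 3 / 2 := by
  rw [show (3 / 2 : ℝ) = Real.sqrt ((3 / 2) ^ 2) by rw [Real.sqrt_sq (by norm_num)]]; exact Real.sqrt_le_sqrt (by norm_num)

/-- THE REDUCTION, FINITE-MESH FORM: mesh-uniform continuity of crude bond-`ℤ²` crossing probabilities of `R` in the
discretisation of the domain implies the finite-mesh comparison
`gaugeCrossingProb 0 (e^{iπ/4} R) δ - bondStdCrossingProb R (2δ) → 0` (renewal coupling + SLLN for the grid + the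
sandwich). [folklore] -/
theorem freezeComparisonAt_of_continuity (R : ConformalRectangle) (hC : CrudeCrossingContinuity R) :
    FreezeComparisonAt R := by
  rw [FreezeComparisonAt, Metric.tendsto_nhds]
  intro ε hε
  obtain ⟨κ, hκ, ρ, hρ, hev⟩ := hC (ε / 3) (by positivity)
  obtain ⟨Rad₀, hRad₀, hΩ⟩ := R.isBounded.subset_ball_lt 0 (0 : ℂ)
  set Rad : ℝ := Rad₀ + κ + ρ + 1 with hRad
  have hRadΩ : R.carrier ⊆ Metric.ball 0 Rad := hΩ.trans (Metric.ball_subset_ball (by linarith))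
  have hRadE : enlarge R κ ⊆ Metric.ball 0 Rad :=
    (enlarge_subset_ball R hΩ hκ.le).trans (Metric.ball_subset_ball (by linarith))
  set θ : ℝ := min (1 / 2) (ρ / (8 * Rad + 20)) with hθ
  have hθpos : 0 < θ := lt_min (by norm_num) (by positivity)
  have hθhalf : θ ≤ 1 / 2 := min_le_left _ _
  have hθρ : θ * (8 * Rad + 20) ≤ ρ := by
    have := min_le_right (1 / 2 : ℝ) (ρ / (8 * Rad + 20))
    rw [← hθ] at this
    rwa [le_div_iff₀ (by positivity)] at this
  set Mof : ℝ → ℕ := fun δ => ⌈2 * Rad / δ⌉₊ + 4 with hMof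
  set P := bondPercolation (zdGraph 2) half with hP
  -- the bad-grid probability vanishes along `δ → 0⁺`
  have hdiv : Tendsto (fun δ : ℝ => 2 * Rad / δ) (𝓝[>] 0) atTop := by
    simp_rw [div_eq_mul_inv]
    exact tendsto_inv_nhdsGT_zero.const_mul_atTop (by positivity)
  have hM : Tendsto Mof (𝓝[>] 0) atTop :=
    tendsto_atTop_mono (fun δ => Nat.le_add_right _ 4) (tendsto_nat_ceil_atTop.comp hdiv)
  have hbad : Tendsto (fun δ => bitLaw.real {A | ¬ GoodGrid A (Mof δ) θ}) (𝓝[>] 0) (𝓝 0) := by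
    have h1 := (tendsto_measure_not_goodGrid hθpos).comp hM
    have h2 := (ENNReal.tendsto_toReal ENNReal.zero_ne_top).comp h1
    rwa [ENNReal.toReal_zero] at h2
  have hbad' : ∀ᶠ δ in 𝓝[>] (0 : ℝ), bitLaw.real {A | ¬ GoodGrid A (Mof δ) θ} < ε / 6 := by
    have := Metric.tendsto_nhds.1 hbad (ε / 6) (by positivity)
    filter_upwards [this] with δ hδ
    rwa [Real.dist_0_eq_abs, abs_of_nonneg measureReal_nonneg] at hδ
  -- continuity at mesh `2δ`
  have hcont : ∀ᶠ δ in 𝓝[>] (0 : ℝ), P.real (upperCrossing R ρ (2 * δ)) ≤ P.real (lowerCrossing R κ ρ (2 * δ)) + ε / 3 :=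
    (tendsto_const_mul_nhdsGT_zero two_pos).eventually hev
  -- small meshes
  have hsmall : ∀ᶠ δ in 𝓝[>] (0 : ℝ), δ < min 1 (min (ρ / 12) (κ / 3)) :=
    (eventually_lt_nhds (by positivity)).filter_mono nhdsWithin_le_nhds
  have hpos : ∀ᶠ δ in 𝓝[>] (0 : ℝ), 0 < δ := eventually_mem_nhdsWithin
  filter_upwards [hbad', hcont, hsmall, hpos] with δ hb hc hs hδ
  have hδ1 : δ < 1 := lt_of_lt_of_le hs (min_le_left _ _)
  have hδρ : δ < ρ / 12 := lt_of_lt_of_le hs ((min_le_right _ _).trans (min_le_left _ _))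
  have hδκ : δ < κ / 3 := lt_of_lt_of_le hs ((min_le_right _ _).trans (min_le_right _ _))
  -- the parameters of the sandwich at this mesh
  have hceil : (2 * Rad / δ : ℝ) ≤ ⌈2 * Rad / δ⌉₊ := Nat.le_ceil _
  have hceil' : (⌈2 * Rad / δ⌉₊ : ℝ) < 2 * Rad / δ + 1 := Nat.ceil_lt_add_one (by positivity)
  have hMδ : ((Mof δ : ℕ) : ℝ) = (⌈2 * Rad / δ⌉₊ : ℝ) + 4 := by simp [hMof]
  set n : ℝ := (⌈2 * Rad / δ⌉₊ : ℝ) with hn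
  have he : δ * (2 * Rad / δ) = 2 * Rad := by field_simp
  have hc1 : 2 * Rad ≤ δ * n := by
    have := mul_le_mul_of_nonneg_left hceil hδ.le
    rwa [he] at this
  have hc2 : δ * n ≤ 2 * Rad + δ := by
    have := mul_le_mul_of_nonneg_left hceil'.le hδ.le
    rwa [mul_add, he, mul_one] at this
  have hRM : 2 * Rad + 4 * δ ≤ δ * (Mof δ : ℕ) := by
    rw [hMδ]
    have : δ * (n + 4) = δ * n + 4 * δ := by ring
    rw [this]; linarith
  have hdisp : δ * (2 * θ * (Mof δ : ℕ) + 6) ≤ ρ := by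
    rw [hMδ]
    have h2 : δ * (2 * θ * (n + 4) + 6) = 2 * θ * (δ * n) + 8 * (θ * δ) + 6 * δ := by ring
    rw [h2]
    have h3 : 2 * θ * (δ * n) ≤ 2 * θ * (2 * Rad + δ) := mul_le_mul_of_nonneg_left hc2 (by positivity)
    have h4 : θ * δ ≤ θ := by nlinarith
    have h5 : 2 * θ * (2 * Rad + δ) = 4 * θ * Rad + 2 * (θ * δ) := by ring
    have h6 : θ * (8 * Rad + 20) = 8 * (θ * Rad) + 20 * θ := by ring
    nlinarith [h3, h4, hθρ, hδρ, hθpos, h5, h6]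
  have hκ' : Real.sqrt 2 * δ ≤ κ := by nlinarith [sqrt_two_le_three_halves, Real.sqrt_nonneg 2, hδκ, hδ]
  have hκ'' : Real.sqrt 2 * (2 * δ) ≤ κ := by nlinarith [sqrt_two_le_three_halves, Real.sqrt_nonneg 2, hδκ, hδ]
  obtain ⟨hL, hU⟩ := gaugeCrossingProb_zero_mem_Icc hδ hθhalf hRM hdisp hρ.le hκ' R hRadΩ hRadE
  -- the standard family is sandwiched by the same events
  have h1 : bondStdCrossingProb R (2 * δ) ≤ P.real (upperCrossing R ρ (2 * δ)) := by
    have hsub := embDomainCrossing_subset_upperCrossing R (δ := 2 * δ) (ρ := ρ) (by linarith) (by linarith)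
    unfold bondStdCrossingProb
    exact measureReal_mono hsub
  have h2 : P.real (lowerCrossing R κ ρ (2 * δ)) ≤ bondStdCrossingProb R (2 * δ) := by
    -- a.s. the configuration lives on the lattice edges
    rw [bondStdCrossingProb, ← hP, measureReal_def, measureReal_def]
    refine ENNReal.toReal_mono (measure_ne_top _ _) (measure_mono_ae ?_)
    have hae : ∀ᵐ ω ∂P, ω ⊆ (zdGraph 2).edgeSet := ProbabilityTheory.setBernoulli_ae_subset
    filter_upwards [hae] with ω hω hmem
    exact lowerCrossing_subset_embDomainCrossing R (by linarith) hρ.le hκ'' hω hmem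
  rw [Real.dist_0_eq_abs, abs_lt]; constructor <;> linarith

/-- THE REDUCTION, LIMIT-TRANSFER FORM at one conformal rectangle. [folklore] -/
theorem freezeHomogenisationAt_of_continuity (R : ConformalRectangle) (hC : CrudeCrossingContinuity R) :
    FreezeHomogenisationAt R := freezeHomogenisationAt_of_comparisonAt (freezeComparisonAt_of_continuity R hC)

end Freeze

/-- ANCHOR (registered sub-goal). THE REDUCTION OF THE REGISTERED STUB `stub_FreezeHomogenisation` TO ONE CONTINUITY
STATEMENT: if for every conformal rectangle the crude bond-`ℤ²` crossing probabilities are mesh-uniformly insensitive to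
the discretisation of the domain (`Freeze.CrudeCrossingContinuity`, a sub-goal of the line), the stub holds verbatim;
everything else (freeze identification, renewal coupling in law, SLLN for the grid, identification, sandwich) is
proved. [folklore] -/
theorem stub_FreezeHomogenisation_of_continuity :
    (∀ R : ConformalRectangle, Freeze.CrudeCrossingContinuity R) →
    ∀ (R : ConformalRectangle) (L : ℝ),
      Tendsto (gaugeCrossingProb 0
          (R.map (Homeomorph.mulLeft₀ (Complex.exp (((Real.pi / 4 : ℝ) : ℂ) * Complex.I)) (Complex.exp_ne_zero _))))
        (𝓝[>] 0) (𝓝 L) →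
      Tendsto (bondStdCrossingProb R) (𝓝[>] 0) (𝓝 L) :=
  fun hC R => Freeze.freezeHomogenisationAt_of_continuity R (hC R)

end Summit.CriticalPhenomena.CardyFormulaZ2.Theorems.CornerLineDescent.SymmetricSeed
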